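import Mathlib.Analysis.InnerProductSpace.Projection.Reflection
import Mathlib.MeasureTheory.Integral.IntervalIntegral.Basic
import Mathlib.MeasureTheory.Measure.WithDensity
import Mathlib.MeasureTheory.Measure.Prod
import Literature.Analysis.FunctionSpaces.PoissonPointProcess
import Literature.Analysis.FluidPDE.HardSpherePhaseSpace
import Literature.Analysis.FluidPDE.HardSphereDynamics
import Literature.Analysis.FluidPDE.BoltzmannEquation
import Literature.Analysis.FluidPDE.BBGKYMarginals
import HarnessLib

-- provenance: harness21/H21/H21/Prelude/AnalysisL/LorentzGas.lean @ 990e377 (interim HEAD d8f2665); M5 mechanical rewrite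
/-!
# The Lorentz gas and the linear Boltzmann equations
(trunk T-KINETIC, group G28 AnalysisL, item P12; notions `boltzmann_grad_limit_notion`,
`hard_sphere_dynamics`, `boltzmann_collision_operator`)

Three pieces of kinetic theory needed for the short-range / Lorentz-gas follow-ups of
hilbert6.S22 (Gallavotti–Spohn, Bodineau–Gallagher–Saint-Raymond):

1. **The Lorentz gas.** A point particle moving freely in `ℝ^d` among *fixed* ball scatterers of
   RADIUS `ε` centred at the points of a locally finite configuration `c : PointConfig E`
   (`E = EuclideanSpace ℝ d`), specularly reflected at the obstacles: the phase domain
   `Kinetic.lorentzDomain`, trajectories `Kinetic.IsLorentzTrajectory`, and the a.e.-defined flow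
   for a *random* (Poisson) configuration as a hypothesis structure `Kinetic.LorentzFlow ε P`
   copying the accepted `Kinetic.HardSphereFlow` (good set of full measure, group law, measurable,
   trajectories on the good set), its existence `LorentzFlow.nonempty` (sorried), and the annealed
   observable `Kinetic.lorentzExpectation` (Gallavotti 1969; Spohn, Comm. Math. Phys. 60 (1978);
   Boldrighini–Bunimovich–Sinai, J. Stat. Phys. 32 (1983); Spohn, Rev. Mod. Phys. 52 (1980) §?).
2. **Linear collision operators and mild linear equations.** The linear Lorentz operator
   `Kinetic.lorentzCollisionOp f v = ∫_{S^{d-1}} (v·ω)₊ (f(v - 2(v·ω)ω) - f(v)) dω`, the linear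
   Boltzmann collision term of a tagged particle against a background `M`,
   `Kinetic.linearCollisionTerm B M f = Q_B(f, M)`, and the corresponding mild (Duhamel along
   free flight) solution structures `Kinetic.IsMildLinearLorentzSolutionOn`,
   `Kinetic.IsMildLinearBoltzmannSolutionOn`, verbatim the shape of the accepted
   `Kinetic.IsMildBoltzmannSolutionOn` (GST 2013 §2.1) with the collision term replaced;
   global well-posedness `Kinetic.existsUnique_mildLinearBoltzmann` (sorried; Spohn RMP 52 (1980)
   §?; Bodineau–Gallagher–Saint-Raymond, Invent. Math. 203 (2016) (1.7)).
3. **A tagged sphere in a hard-sphere gas at equilibrium.** The one-time law of particle `0`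
   of an `(N+1)`-hard-sphere system, `Kinetic.taggedLaw`, its position marginal
   `Kinetic.taggedPositionLaw`, and the perturbed-equilibrium initial density
   `Kinetic.equilibriumTaggedDensity` `= 𝒵⁻¹ 𝟙_{D_ε} ∏ᵢ M_β(vᵢ) h₀(z₀)` with its partition
   function `Kinetic.equilibriumTaggedPartition` (BGSR 2016 (1.4)–(1.5)).

## Mathlib / H21 reuse

Mathlib has no Lorentz gas, billiard flow or linear Boltzmann equation (grep
`lorentz.?gas|linear.?boltzmann|billiard|specular`: nothing). Reused from Mathlib: the specular
reflection is `Submodule.reflection (ℝ ∙ n)ᗮ` (`Mathlib.Analysis.InnerProductSpace.Projection.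
Reflection`, `Submodule.reflection_singleton_apply`), `Measure.prod`, `Measure.map`,
`Measure.withDensity`, `Measure.restrict`, `intervalIntegral`, `nhdsWithin`. From H21:
`PointConfig`, `IsPoissonPointProcess` (P10); `Kinetic.Geometry`, `Config`, `hardSphereDomain`,
`liouville`, `reflectVel` (G12 K1); `HardSphereFlow` (G12 K2); `collisionOpWith`, `alongFlow`,
`IsMildBoltzmannSolutionOn`, `globalMaxwellian`, `localMaxwellian`, `IsGradCutoffKernel` (G12 K4);
`HardSphereFlow.lawAt` (`taggedLaw_eq_map_lawAt`); `tensorPow`, `canonicalPartition`,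
`canonicalDensity` (G12 K3, BBGKYMarginals: the equilibrium partition function is
`canonicalPartition G ε (N+1) (M_β ∘ Prod.snd)` and `equilibriumTaggedDensity` is
`ENNReal.ofReal (canonicalDensity … z * h₀ (z 0))`); `Hilbert6.sphereMeasure` (UNnormalised
`volume.toSphere`), `Hilbert6.hardSphereKernel` (Wave0).

**Overlap with statement-local declarations.** The accepted `Statements/Hilbert6/Sweep1.lean`
contains hard-sphere-specific versions `Hilbert6.taggedDensity` (`β = 1`, `h₀ = ρ₀ ∘ Prod.fst`,
real-valued) and `Hilbert6.IsMildLinearBoltzmannSolutionOn T G α g` (`B = α • hardSphereKernel`,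
`M = globalMaxwellian`, no `nonneg` field). The `Kinetic.*` declarations here are the general
ones intended by the outline (P12); the Sweep1 ones may later be retired in their favour.

## Design choices

* **Radius vs diameter.** G12 hard spheres have DIAMETER `ε` (`hardSphereDomain`: `ε ≤ |xᵢ - xⱼ|`);
  the Lorentz obstacles here have RADIUS `ε` (`lorentzDomain`: `ε ≤ |x - a|`). With radius `ε`
  and Poisson intensity `σ ε^{-(d-1)}` the Boltzmann–Grad coefficient in front of
  `lorentzCollisionOp` is exactly `σ`, because `Hilbert6.sphereMeasure` is unnormalised and
  `lorentzCollisionOp` therefore already contains the total cross-section `∫_{S^{d-1}} (v̂·ω)₊ dω`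
  of the unit ball; with diameter-`ε` obstacles the coefficient would be `σ 2^{-(d-1)}`.
* **`LorentzFlow` is an a.e. hypothesis structure** exactly like `HardSphereFlow`: for a fixed
  configuration the billiard flow is defined only off a Lebesgue-null set of initial data
  (grazing, hitting an intersection of two obstacles, ...), and the null set depends on `c`, so
  the good set lives in `PointConfig E × (E × E)`. The reference measure is
  `lorentzLiouville ε P = (P ⊗ Leb) |_{lorentzPhase ε}` (the analogue of G12's
  `liouville = volume.restrict (hardSphereDomain …)`): the outline's literal
  `(P.prod volume) goodᶜ = 0` together with `good ⊆ lorentzPhase` would be contradictory (the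
  interiors of the obstacles have positive Lebesgue measure), so conullness is required for the
  restricted measure, as in G12. Inside the obstacles `flow` is unspecified junk (measurable);
  in the annealed functional `lorentzExpectation` this junk region has probability `O(ε)` and
  is invisible in the Boltzmann–Grad limit.
* Trajectories are right-continuous at reflection times (as in G12): `γ t` carries the outgoing
  velocity, the incoming one is the left limit.
* Mild linear solutions are pointwise in `(x, v)` (Lanford / BGSR continuous class), fields
  `nonneg`, `intervalIntegrable`, `duhamel` verbatim from `IsMildBoltzmannSolutionOn`.
  Well-posedness of the linear Boltzmann equation is stated in the Maxwellian-weighted class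
  `IsMaxwellianBoundedOn` (`|f| ≤ C M`, continuous), for a CONTINUOUS Grad cut-off kernel `B`
  (a merely measurable `B` can make the loss frequency, hence the solution, discontinuous in
  `v`, and the continuous class empty), as "existence + uniqueness on `t ≥ 0`" rather than a
  (false) `∃!` on functions of all times.
* `equilibriumTaggedDensity` divides by the partition function `equilibriumTaggedPartition`;
  if the latter vanishes or is infinite (junk: too many spheres for the torus, or `X = ℝ^d`) the
  density is junk (`x⁻¹` conventions), documented; `equilibriumTaggedPartition_pos` records
  positivity on the torus under the honest hypothesis that `D_ε^{N+1}` is not Lebesgue-null.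
* No diffusive rescaling / unfolded displacement is defined: the Brownian limit (BGSR Thm 1.2) is
  phrased downstream on the fixed torus at diffusive times and needs only `taggedPositionLaw`.

## References

* G. Gallavotti, *Divergences and approach to equilibrium in the Lorentz and the wind-tree
  models*, Phys. Rev. 185 (1969) / Nota interna Roma (1972).
* H. Spohn, *The Lorentz process converges to a random flight process*, Comm. Math. Phys. 60
  (1978) 277–290; *Kinetic equations from Hamiltonian dynamics*, Rev. Mod. Phys. 52 (1980).
* C. Boldrighini, L. Bunimovich, Ya. Sinai, *On the Boltzmann equation for the Lorentz gas*,
  J. Stat. Phys. 32 (1983).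
* T. Bodineau, I. Gallagher, L. Saint-Raymond, *The Brownian motion as the limit of a
  deterministic system of hard spheres*, Invent. Math. 203 (2016), (1.4)–(1.7), Thm 1.1–1.2.
* I. Gallagher, L. Saint-Raymond, B. Texier, *From Newton to Boltzmann* (2013), §2.1.
-/

open MeasureTheory Metric Real Set Filter Topology
open scoped InnerProductSpace ENNReal

namespace Literature.Analysis.FunctionSpaces

noncomputable section

/-! ## 1. The Lorentz gas: a point particle among fixed ball scatterers -/

section LorentzGas

variable {d : Type*} [Fintype d]

local notation "𝔼" => EuclideanSpace ℝ d

/-- The phase domain of the Lorentz gas with scatterer configuration `c` and obstacle RADIUS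
`ε`: states `(x, v) ∈ ℝ^d × ℝ^d` whose position is at distance `≥ ε` from every scatterer centre,
`{(x, v) | ∀ a ∈ c, ε ≤ |x - a|}` (closed: contact `|x - a| = ε` included). Note the convention:
G12's `hardSphereDomain` uses spheres of DIAMETER `ε`; here obstacles are balls of RADIUS `ε`, so
that at Poisson intensity `σ ε^{-(d-1)}` the Boltzmann–Grad coefficient in front of
`lorentzCollisionOp` is exactly `σ` (Gallavotti 1969; Spohn CMP 60 (1978) §1).
[cite: GallavottiPR1969] -/
def lorentzDomain (ε : ℝ) (c : PointConfig 𝔼) : Set (𝔼 × 𝔼) :=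
  {z | ∀ a ∈ c, ε ≤ ‖z.1 - a‖}

/-- Membership in the Lorentz domain. [folklore] -/
theorem mem_lorentzDomain {ε : ℝ} {c : PointConfig 𝔼} {z : 𝔼 × 𝔼} :
    z ∈ lorentzDomain ε c ↔ ∀ a ∈ c, ε ≤ ‖z.1 - a‖ :=
  Iff.rfl

/-- With no scatterers the Lorentz domain is everything. [folklore] -/
@[simp]
theorem lorentzDomain_empty (ε : ℝ) : lorentzDomain ε (∅ : PointConfig 𝔼) = univ := by
  ext z
  simp only [mem_lorentzDomain, mem_univ, iff_true]
  intro a ha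
  exact absurd (show a ∈ (∅ : PointConfig 𝔼).carrier from ha) (by simp)

/-- The set of reflection (contact) times of a curve `γ` in the Lorentz gas: times at which the
particle touches some obstacle, `|x(t) - a| = ε` for some `a ∈ c` (Spohn CMP 60 (1978) §1).
[folklore] -/
def lorentzCollisionTimes (ε : ℝ) (c : PointConfig 𝔼) (γ : ℝ → 𝔼 × 𝔼) : Set ℝ :=
  {t | ∃ a ∈ c, ‖(γ t).1 - a‖ = ε}

/-- Membership in the set of reflection times. [folklore] -/
theorem mem_lorentzCollisionTimes {ε : ℝ} {c : PointConfig 𝔼} {γ : ℝ → 𝔼 × 𝔼} {t : ℝ} :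
    t ∈ lorentzCollisionTimes ε c γ ↔ ∃ a ∈ c, ‖(γ t).1 - a‖ = ε :=
  Iff.rfl

/-- The specular reflection of a velocity `v` at an obstacle with outward normal direction `n`
(any nonzero multiple of the unit normal): `v ↦ v - 2 (⟪v, n⟫ / |n|²) n`, i.e. Mathlib's
orthogonal reflection `Submodule.reflection (ℝ ∙ n)ᗮ` in the tangent hyperplane
(`specularReflect_eq`; Spohn CMP 60 (1978) §1). This is the one-particle (infinite-mass
obstacle) analogue of G12's two-body law `Kinetic.reflectVel n`: `specularReflect n v =
(reflectVel n (v, -v)).1` (`specularReflect_eq_reflectVel`). At `n = 0` it is the identity.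
An `abbrev`, so that the `Submodule.reflection` API applies without unfolding. [folklore] -/
abbrev specularReflect (n v : 𝔼) : 𝔼 :=
  (ℝ ∙ n)ᗮ.reflection v

/-- The explicit formula `specularReflect n v = v - (2 * ⟪v, n⟫ / ‖n‖ ^ 2) • n`
(`Submodule.reflection_singleton_apply`, `Submodule.reflection_orthogonal_apply`). [folklore] -/
theorem specularReflect_eq (n v : 𝔼) :
    specularReflect n v = v - (2 * ⟪v, n⟫_ℝ / ‖n‖ ^ 2) • n := by
  rw [specularReflect, Submodule.reflection_orthogonal_apply, Submodule.reflection_singleton_apply,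
    neg_sub, ← Nat.cast_smul_eq_nsmul ℝ, smul_smul, real_inner_comm n v]
  congr 1
  simp only [RCLike.ofReal_real_eq_id, id_eq]
  push_cast
  ring_nf

/-- For a unit normal `‖n‖ = 1`: `specularReflect n v = v - (2 * ⟪v, n⟫) • n`
(Spohn CMP 60 (1978) (1.?)). [folklore] -/
theorem specularReflect_eq_of_norm_eq_one {n : 𝔼} (hn : ‖n‖ = 1) (v : 𝔼) :
    specularReflect n v = v - (2 * ⟪v, n⟫_ℝ) • n := by
  rw [specularReflect_eq, hn, one_pow, div_one]

/-- The specular reflection is the first component of G12's two-body elastic law applied to the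
pair `(v, -v)` (an obstacle is a partner of opposite velocity and infinite mass in the limit;
purely algebraic identity). [folklore] -/
theorem specularReflect_eq_reflectVel (n v : 𝔼) :
    specularReflect n v = (FluidPDE.reflectVel n (v, -v)).1 := by
  rw [specularReflect_eq, FluidPDE.reflectVel]
  simp only [sub_neg_eq_add]
  congr 2
  rw [← two_smul ℝ v, inner_smul_left, RCLike.conj_to_real]

/-- `γ : ℝ → ℝ^d × ℝ^d` is a *Lorentz-gas trajectory* among ball obstacles of radius `ε` centred
at the points of `c` (Gallavotti 1969; Spohn CMP 60 (1978) §1; Boldrighini–Bunimovich–Sinai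
1983 §1): it stays in the Lorentz domain, its reflection times are locally finite, the position
is continuous, it is free flight `(x + (t - s) v, v)` on every reflection-free interval `(s, t]`
(hence velocities are right-continuous), and at a reflection time the particle touches exactly
one obstacle `a`, the incoming velocity `v⁻` (left limit) points into the obstacle,
`⟪v⁻, x - a⟫ < 0` (no grazing), and the outgoing velocity is its specular reflection
`v⁺ = v⁻ - 2 ⟪v⁻, n⟫ n`, `n = ε⁻¹ (x - a)` (`specularReflect`, `= Submodule.reflection (ℝ ∙ n)ᗮ`).
[cite: GallavottiPR1969] -/
structure IsLorentzTrajectory (ε : ℝ) (c : PointConfig 𝔼) (γ : ℝ → 𝔼 × 𝔼) : Prop where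
  /-- The trajectory stays outside the (open) obstacles. -/
  mem : ∀ t, γ t ∈ lorentzDomain ε c
  /-- Reflection times are locally finite. -/
  locFinite : ∀ a b, (lorentzCollisionTimes ε c γ ∩ Icc a b).Finite
  /-- The position is continuous in time. -/
  pos_continuous : Continuous fun t => (γ t).1
  /-- Free flight on reflection-free intervals `(s, t]`. -/
  free : ∀ s t, s ≤ t → (∀ τ ∈ Ioc s t, τ ∉ lorentzCollisionTimes ε c γ) →
    γ t = ((γ s).1 + (t - s) • (γ s).2, (γ s).2)
  /-- At a reflection time a single obstacle is touched, from an incoming left-limit velocity,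
  and the velocity is specularly reflected. -/
  reflect : ∀ t, ∀ a ∈ c, ‖(γ t).1 - a‖ = ε →
    (∀ a' ∈ c, ‖(γ t).1 - a'‖ = ε → a' = a) ∧
    ∃ vl : 𝔼, Tendsto (fun s => (γ s).2) (𝓝[<] t) (𝓝 vl) ∧ ⟪vl, (γ t).1 - a⟫_ℝ < 0 ∧
      (γ t).2 = specularReflect (ε⁻¹ • ((γ t).1 - a)) vl

namespace IsLorentzTrajectory

variable {ε : ℝ} {c : PointConfig (EuclideanSpace ℝ d)}
  {γ : ℝ → EuclideanSpace ℝ d × EuclideanSpace ℝ d}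

/-- Conservation of speed along a Lorentz trajectory: free flight keeps `v`, specular reflection
is an isometry (Spohn CMP 60 (1978) §1). [cite: Spohn1978, §1] -/
def norm_snd_eq : Prop :=
  ∀ (h : IsLorentzTrajectory ε c γ) (s t : ℝ),
    ‖(γ s).2‖ = ‖(γ t).2‖

/-- With no obstacles a Lorentz trajectory is global free flight. [folklore] -/
theorem eq_of_empty (h : IsLorentzTrajectory ε (∅ : PointConfig 𝔼) γ) {s t : ℝ} (hst : s ≤ t) :
    γ t = ((γ s).1 + (t - s) • (γ s).2, (γ s).2) :=
  h.free s t hst fun τ _ ⟨a, ha, _⟩ =>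
    absurd (show a ∈ (∅ : PointConfig 𝔼).carrier from ha) (by simp)

end IsLorentzTrajectory

/-! ### The Lorentz flow for a random configuration (a good-set hypothesis structure) -/

/-- The phase space of the annealed Lorentz gas: pairs (configuration, state) with the state in
the Lorentz domain of the configuration, `{(c, z) | z ∈ lorentzDomain ε c}`. [folklore] -/
def lorentzPhase (ε : ℝ) : Set (PointConfig 𝔼 × (𝔼 × 𝔼)) :=
  {p | p.2 ∈ lorentzDomain ε p.1}

/-- Membership in the annealed phase space. [folklore] -/
theorem mem_lorentzPhase {ε : ℝ} {p : PointConfig 𝔼 × (𝔼 × 𝔼)} :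
    p ∈ lorentzPhase ε ↔ p.2 ∈ lorentzDomain ε p.1 :=
  Iff.rfl

/-- The reference measure of the annealed Lorentz gas with scatterer law `P`: the product
`P ⊗ Leb` of the configuration law with Lebesgue measure on `ℝ^d × ℝ^d`, restricted to the
annealed phase space `lorentzPhase ε` (the analogue of G12's `Kinetic.liouville`; Spohn CMP 60
(1978) §1: initial state distributed independently of the obstacles, outside them). [folklore] -/
def lorentzLiouville (ε : ℝ) (P : Measure (PointConfig 𝔼)) : Measure (PointConfig 𝔼 × (𝔼 × 𝔼)) :=
  (P.prod volume).restrict (lorentzPhase ε)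

/-- Unfolding lemma for `lorentzLiouville`. [folklore] -/
theorem lorentzLiouville_eq (ε : ℝ) (P : Measure (PointConfig 𝔼)) :
    lorentzLiouville ε P = (P.prod volume).restrict (lorentzPhase ε) := rfl

/-- The Lorentz-gas flow for a random scatterer configuration of law `P` and obstacle radius `ε`,
bundled with its defining properties — an a.e. *hypothesis structure* field for field like G12's
`Kinetic.HardSphereFlow` (Spohn CMP 60 (1978) §1; Boldrighini–Bunimovich–Sinai 1983 §1): a
measurable *good set* `good ⊆ lorentzPhase ε` of pairs (configuration, initial state), conull for
`lorentzLiouville ε P = (P ⊗ Leb)|_{lorentzPhase ε}` and invariant, on which `flow c` is a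
one-parameter group of Lorentz trajectories among the obstacles of `c`; the flow is jointly
measurable in `(c, t, z)` and preserves `lorentzLiouville ε P`. Outside `good` (in particular
inside the obstacles) the values of `flow` are unspecified junk.
[cite: BoldrighiniBunimovichSinai1983, §1] -/
structure LorentzFlow (ε : ℝ) (P : Measure (PointConfig 𝔼)) where
  /-- The flow map `(c, t, z) ↦ T^c_t z`. -/
  flow : PointConfig 𝔼 → ℝ → 𝔼 × 𝔼 → 𝔼 × 𝔼
  /-- The good set of (configuration, initial state) pairs. -/
  good : Set (PointConfig 𝔼 × (𝔼 × 𝔼))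
  /-- The good set is measurable. -/
  measurableSet_good : MeasurableSet good
  /-- Good states lie outside the obstacles. -/
  good_subset : good ⊆ lorentzPhase ε
  /-- The good set is conull for `(P ⊗ Leb)|_{lorentzPhase ε}`. -/
  measure_compl_good : lorentzLiouville ε P goodᶜ = 0
  /-- The good set is invariant under the flow (the configuration does not move). -/
  mapsTo_good : ∀ t, MapsTo (fun p : PointConfig 𝔼 × (𝔼 × 𝔼) => (p.1, flow p.1 t p.2)) good good
  /-- `T_0 = id` on the good set. -/
  flow_zero : ∀ p ∈ good, flow p.1 0 p.2 = p.2
  /-- The group property `T_{s+t} = T_s ∘ T_t` on the good set. -/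
  flow_add : ∀ s t, ∀ p ∈ good, flow p.1 (s + t) p.2 = flow p.1 s (flow p.1 t p.2)
  /-- Joint measurability in (configuration, time, state). -/
  measurable_flow : Measurable fun p : PointConfig 𝔼 × ℝ × (𝔼 × 𝔼) => flow p.1 p.2.1 p.2.2
  /-- Orbits of good points are Lorentz trajectories. -/
  isTrajectory : ∀ p ∈ good, IsLorentzTrajectory ε p.1 fun t => flow p.1 t p.2
  /-- Each time-`t` map preserves the annealed Liouville measure. -/
  measurePreserving : ∀ t,
    MeasurePreserving (fun p : PointConfig 𝔼 × (𝔼 × 𝔼) => (p.1, flow p.1 t p.2))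
      (lorentzLiouville ε P) (lorentzLiouville ε P)

namespace LorentzFlow

variable {ε : ℝ} {P : Measure (PointConfig (EuclideanSpace ℝ d))}

/-- `lorentzLiouville`-almost every (configuration, state) is good. [folklore] -/
theorem ae_mem_good (Φ : LorentzFlow ε P) : ∀ᵐ p ∂lorentzLiouville ε P, p ∈ Φ.good :=
  Φ.measure_compl_good

/-- For a fixed configuration, each time-`t` map of the flow is measurable. [folklore] -/
theorem measurable_flow_apply (Φ : LorentzFlow ε P) (c : PointConfig 𝔼) (t : ℝ) :
    Measurable (Φ.flow c t) :=
  Φ.measurable_flow.comp (measurable_const.prodMk (measurable_const.prodMk measurable_id))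

/-- On the good set `T_{-t}` inverts `T_t`. [folklore] -/
theorem flow_neg_flow (Φ : LorentzFlow ε P) (t : ℝ) {p : PointConfig 𝔼 × (𝔼 × 𝔼)}
    (hp : p ∈ Φ.good) : Φ.flow p.1 (-t) (Φ.flow p.1 t p.2) = p.2 := by
  rw [← Φ.flow_add (-t) t p hp, neg_add_cancel, Φ.flow_zero p hp]

end LorentzFlow

/-- **Existence of the Lorentz flow** for Poisson scatterers (Spohn CMP 60 (1978) §1;
Boldrighini–Bunimovich–Sinai 1983 §1; for a fixed locally finite configuration the billiard
flow among finitely many balls per bounded region is defined off a Lebesgue-null set of initial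
data — grazing collisions, hits of intersections of obstacles, accumulation of reflections — and
preserves Liouville measure; measurability in the configuration for the count σ-algebra): for a
Poisson point process of finite constant intensity `r • Leb` and `ε > 0` a `LorentzFlow` exists.
[cite: BoldrighiniBunimovichSinai1983, §1] -/
def LorentzFlow.nonempty : Prop :=
  ∀ {r : ℝ≥0∞} (hr : r ≠ ∞) {P : Measure (PointConfig 𝔼)} (hP : IsPoissonPointProcess (r • (volume : Measure 𝔼)) P) {ε : ℝ} (hε : 0 < ε),
    Nonempty (LorentzFlow ε P)

/-- The *annealed* Lorentz-gas observable at time `t`: average over the scatterer law `P` and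
over initial states of density `f₀` (w.r.t. Lebesgue on `ℝ^d × ℝ^d`) of a test function `φ`
evaluated along the flow, `∫ (∫ φ(T^c_t z) f₀(z) dz) P(dc)` (Gallavotti 1969; Spohn CMP 60 (1978)
Thm; the quantity whose `ε → 0` limit is `∫ φ f(t)` with `f` the linear Lorentz–Boltzmann
solution). Bochner integrals, junk value `0`. The scatterer law `P` (and `ε`) are implicit,
inferred from `Φ`: downstream (S1(b)) one writes `lorentzExpectation (Φ ε) f₀ t φ`.
[cite: GallavottiPR1969] -/
def lorentzExpectation {ε : ℝ} {P : Measure (PointConfig 𝔼)} (Φ : LorentzFlow ε P)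
    (f₀ : 𝔼 × 𝔼 → ℝ) (t : ℝ) (φ : 𝔼 × 𝔼 → ℝ) : ℝ :=
  ∫ c, ∫ z, φ (Φ.flow c t z) * f₀ z ∂volume ∂P

end LorentzGas

/-! ## 2. Linear collision operators and mild linear equations -/

section LinearOperators

variable {E : Type*} [NormedAddCommGroup E] [InnerProductSpace ℝ E] [FiniteDimensional ℝ E]
  [MeasurableSpace E] [BorelSpace E]

/-- The *linear Lorentz (hard-obstacle) collision operator*
`(L f)(v) = ∫_{S^{d-1}} (v·ω)₊ (f(v - 2 (v·ω) ω) - f(v)) dω` — specular reflection of the velocity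
at a uniformly "illuminated" unit ball (Gallavotti 1969; Spohn CMP 60 (1978) (1.?), RMP 52 (1980)
§?; Boldrighini–Bunimovich–Sinai 1983). The measure is the accepted UNnormalised surface measure
`Hilbert6.sphereMeasure = volume.toSphere`, so `L` ALREADY contains the total cross-section
`∫ (v̂·ω)₊ dω = |B^{d-1}| |v|` of the unit ball: for obstacles of radius `ε` at Poisson intensity
`σ ε^{-(d-1)}` the limiting equation is `∂ₜ f + v·∇ₓ f = σ L f` with no further constant. This is
a LINEAR operator in `f` and is a different object from the accepted *linearised* operator
`Literature.Analysis.UnboundedOperators.hardSphereLinearizedOp` (Prelude/UnbddOp/LinearizedBoltzmann, hilbert6.S19), which is the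
linearisation of the quadratic hard-sphere operator around a Maxwellian; and different again
from the linear Boltzmann term `linearCollisionTerm B M` below (tagged particle in a moving
background). Bochner integral, junk value `0`. [cite: GallavottiPR1969] -/
def lorentzCollisionOp (f : E → ℝ) (v : E) : ℝ :=
  ∫ ω : sphere (0 : E) 1, max ⟪v, (ω : E)⟫_ℝ 0 * (f (v - (2 * ⟪v, (ω : E)⟫_ℝ) • (ω : E)) - f v)
    ∂Literature.MathematicalPhysics.KineticTheory.sphereMeasure

/-- The linear Lorentz operator annihilates constants (conservation of mass; the integrand
vanishes identically). [folklore] -/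
@[simp]
theorem lorentzCollisionOp_const (a : ℝ) : lorentzCollisionOp (fun _ : E => a) = 0 := by
  funext v
  simp [lorentzCollisionOp]

/-- The linear Lorentz operator is linear: `L (a • f + g) = a • L f + L g`, provided both
integrands are integrable on the sphere at `v` (Spohn RMP 52 (1980) §?). [folklore] -/
theorem lorentzCollisionOp_add_smul (a : ℝ) (f g : E → ℝ) (v : E)
    (hf : Integrable (fun ω : sphere (0 : E) 1 =>
      max ⟪v, (ω : E)⟫_ℝ 0 * (f (v - (2 * ⟪v, (ω : E)⟫_ℝ) • (ω : E)) - f v)) Literature.MathematicalPhysics.KineticTheory.sphereMeasure)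
    (hg : Integrable (fun ω : sphere (0 : E) 1 =>
      max ⟪v, (ω : E)⟫_ℝ 0 * (g (v - (2 * ⟪v, (ω : E)⟫_ℝ) • (ω : E)) - g v))
      Literature.MathematicalPhysics.KineticTheory.sphereMeasure) :
    lorentzCollisionOp (a • f + g) v = a * lorentzCollisionOp f v + lorentzCollisionOp g v := by
  unfold lorentzCollisionOp
  rw [← integral_const_mul, ← integral_add (hf.const_mul a) hg]
  congr 1
  funext ω
  simp only [Pi.add_apply, Pi.smul_apply, smul_eq_mul]
  ring

omit [FiniteDimensional ℝ E] [MeasurableSpace E] [BorelSpace E] in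
/-- The specularly reflected velocity has the same norm: `|v - 2(v·ω)ω| = |v|` for `ω ∈ S^{d-1}`
(so `L` acts fibrewise on energy shells; Spohn CMP 60 (1978) §1). [folklore] -/
theorem norm_sub_two_mul_inner_smul (v : E) (ω : sphere (0 : E) 1) :
    ‖v - (2 * ⟪v, (ω : E)⟫_ℝ) • (ω : E)‖ = ‖v‖ := by
  have h := Literature.MathematicalPhysics.KineticTheory.real_inner_self_sphere ω
  have : ‖v - (2 * ⟪v, (ω : E)⟫_ℝ) • (ω : E)‖ ^ 2 = ‖v‖ ^ 2 := by
    rw [← real_inner_self_eq_norm_sq, ← real_inner_self_eq_norm_sq, inner_sub_left,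
      inner_sub_right, inner_sub_right, inner_smul_left, inner_smul_right, inner_smul_left,
      inner_smul_right, h, real_inner_comm (ω : E) v]
    simp only [RCLike.conj_to_real]
    ring
  have h0 : 0 ≤ ‖v - (2 * ⟪v, (ω : E)⟫_ℝ) • (ω : E)‖ := norm_nonneg _
  nlinarith [norm_nonneg v, sq_nonneg (‖v - (2 * ⟪v, (ω : E)⟫_ℝ) • (ω : E)‖ - ‖v‖),
    sq_nonneg (‖v - (2 * ⟪v, (ω : E)⟫_ℝ) • (ω : E)‖ + ‖v‖)]

variable {X : Type*}

/-- The linear Lorentz collision term with coefficient `σ` of a one-particle density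
`f(s, y, ·)`, frozen in `(s, y)`: `(s, y) ↦ σ • L (f(s, y, ·))` (Spohn CMP 60 (1978) Thm).
[folklore] -/
def lorentzCollisionTerm (σ : ℝ) (f : ℝ → X → E → ℝ) : ℝ → X → E → ℝ :=
  fun s y => σ • lorentzCollisionOp (f s y)

/-- The *linear Boltzmann collision term* of a tagged particle of density `f(s, y, ·)` in a
background of fixed velocity distribution `M` (e.g. `globalMaxwellian`), frozen in `(s, y)`:
`(s, y) ↦ Q_B(f(s, y, ·), M) = ∫∫ B (f(v') M(v_*') - f(v) M(v_*)) dω dv_*`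
(Bodineau–Gallagher–Saint-Raymond, Invent. Math. 203 (2016) (1.7); Spohn RMP 52 (1980) §?).
[folklore] -/
def linearCollisionTerm (B : E × E → sphere (0 : E) 1 → ℝ) (M : E → ℝ) (f : ℝ → X → E → ℝ) :
    ℝ → X → E → ℝ :=
  fun s y => FluidPDE.collisionOpWith B (f s y) M

/-- Unfolding lemma for `linearCollisionTerm`. [folklore] -/
@[simp]
theorem linearCollisionTerm_apply (B : E × E → sphere (0 : E) 1 → ℝ) (M : E → ℝ)
    (f : ℝ → X → E → ℝ) (s : ℝ) (y : X) :
    linearCollisionTerm B M f s y = FluidPDE.collisionOpWith B (f s y) M := rfl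

end LinearOperators

section MildLinear

variable {d : Type*} [Fintype d] {X : Type*}

/-- *Mild solution on `[0, T]` of the linear Lorentz–Boltzmann equation*
`∂ₜ f + v·∇ₓ f = σ L f` on the geometry `G` (Spohn CMP 60 (1978) Thm; RMP 52 (1980) §?;
Gallavotti 1969): the shape of G12's `IsMildBoltzmannSolutionOn` (GST 2013 §2.1) with the
collision term replaced by `lorentzCollisionTerm σ f = σ • L (f(s, y, ·))` — `f ≥ 0` and, for
every `(x, v)` and `t ∈ [0, T]`, the collision term is integrable along the characteristic and
Duhamel's formula `f♯(t, x, v) = f(0, x, v) + ∫₀ᵗ (σ L f)♯(τ, x, v) dτ` holds.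
[cite: GST2013, §2.1] -/
structure IsMildLinearLorentzSolutionOn (T : ℝ) (G : FluidPDE.Geometry d X) (σ : ℝ)
    (f : ℝ → X → EuclideanSpace ℝ d → ℝ) : Prop where
  /-- `f(t) ≥ 0` on `[0, T]`. -/
  nonneg : ∀ t ∈ Icc 0 T, ∀ x v, 0 ≤ f t x v
  /-- The collision term is integrable along every characteristic. -/
  intervalIntegrable : ∀ x v, ∀ t ∈ Icc 0 T,
    IntervalIntegrable (fun τ => FluidPDE.alongFlow G (lorentzCollisionTerm σ f) τ x v) volume 0 t
  /-- Duhamel's formula along characteristics. -/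
  duhamel : ∀ x v, ∀ t ∈ Icc 0 T, FluidPDE.alongFlow G f t x v =
    f 0 x v + ∫ τ in (0 : ℝ)..t, FluidPDE.alongFlow G (lorentzCollisionTerm σ f) τ x v

/-- *Mild solution on `[0, T]` of the linear Boltzmann equation* `∂ₜ f + v·∇ₓ f = Q_B(f, M)` for a
tagged particle in the background `M` on the geometry `G` (Bodineau–Gallagher–Saint-Raymond,
Invent. Math. 203 (2016) (1.7) with `M` the Maxwellian and `B` the hard-sphere kernel; Spohn RMP
52 (1980) §?): G12's `IsMildBoltzmannSolutionOn` (GST 2013 §2.1) with the quadratic collision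
term replaced by `linearCollisionTerm B M f`. [cite: GST2013, §2.1] -/
structure IsMildLinearBoltzmannSolutionOn (T : ℝ) (G : FluidPDE.Geometry d X)
    (B : EuclideanSpace ℝ d × EuclideanSpace ℝ d → sphere (0 : EuclideanSpace ℝ d) 1 → ℝ)
    (M : EuclideanSpace ℝ d → ℝ) (f : ℝ → X → EuclideanSpace ℝ d → ℝ) : Prop where
  /-- `f(t) ≥ 0` on `[0, T]`. -/
  nonneg : ∀ t ∈ Icc 0 T, ∀ x v, 0 ≤ f t x v
  /-- The collision term is integrable along every characteristic. -/
  intervalIntegrable : ∀ x v, ∀ t ∈ Icc 0 T,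
    IntervalIntegrable (fun τ => FluidPDE.alongFlow G (linearCollisionTerm B M f) τ x v) volume 0 t
  /-- Duhamel's formula along characteristics. -/
  duhamel : ∀ x v, ∀ t ∈ Icc 0 T, FluidPDE.alongFlow G f t x v =
    f 0 x v + ∫ τ in (0 : ℝ)..t, FluidPDE.alongFlow G (linearCollisionTerm B M f) τ x v

variable {T : ℝ} {G : FluidPDE.Geometry d X} {σ : ℝ}
  {B : EuclideanSpace ℝ d × EuclideanSpace ℝ d → sphere (0 : EuclideanSpace ℝ d) 1 → ℝ}
  {M : EuclideanSpace ℝ d → ℝ} {f : ℝ → X → EuclideanSpace ℝ d → ℝ}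

/-- A mild linear Lorentz solution on `[0, T]` is one on every shorter `[0, T']`. [folklore] -/
theorem IsMildLinearLorentzSolutionOn.mono (hf : IsMildLinearLorentzSolutionOn T G σ f) {T' : ℝ}
    (hT : T' ≤ T) : IsMildLinearLorentzSolutionOn T' G σ f where
  nonneg t ht := hf.nonneg t (Icc_subset_Icc_right hT ht)
  intervalIntegrable x v t ht := hf.intervalIntegrable x v t (Icc_subset_Icc_right hT ht)
  duhamel x v t ht := hf.duhamel x v t (Icc_subset_Icc_right hT ht)

/-- A mild linear Boltzmann solution on `[0, T]` is one on every shorter `[0, T']`. [folklore] -/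
theorem IsMildLinearBoltzmannSolutionOn.mono (hf : IsMildLinearBoltzmannSolutionOn T G B M f)
    {T' : ℝ} (hT : T' ≤ T) : IsMildLinearBoltzmannSolutionOn T' G B M f where
  nonneg t ht := hf.nonneg t (Icc_subset_Icc_right hT ht)
  intervalIntegrable x v t ht := hf.intervalIntegrable x v t (Icc_subset_Icc_right hT ht)
  duhamel x v t ht := hf.duhamel x v t (Icc_subset_Icc_right hT ht)

/-- Maxwellian-weighted boundedness and continuity of a one-particle density on the time slab
`[0, T]`: `f` is continuous on `[0, T] × X × ℝ^d` and `|f(t, x, v)| ≤ C M(v)` there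
(the natural `L^∞(M⁻¹ dv dx)` class of the linear Boltzmann equation, in which the maximum
principle holds; BGSR 2016 §2). [cite: BGSR2016, §2] -/
def IsMaxwellianBoundedOn [TopologicalSpace X] (T : ℝ) (f : ℝ → X → EuclideanSpace ℝ d → ℝ) :
    Prop :=
  ContinuousOn (fun p : ℝ × X × EuclideanSpace ℝ d => f p.1 p.2.1 p.2.2) (Icc 0 T ×ˢ univ) ∧
    ∃ C, ∀ t ∈ Icc 0 T, ∀ x v, |f t x v| ≤ C * FluidPDE.globalMaxwellian v

/-- **Global well-posedness of the linear Boltzmann equation** (tagged particle in the Maxwellian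
background `M = globalMaxwellian` with a *continuous* Grad cut-off kernel; Spohn RMP 52 (1980)
§?; Bodineau–Gallagher–Saint-Raymond 2016 §2, (1.7)): the equation is linear, `M` is a
stationary solution (`Q_B(M, M) = 0`) and the dynamics is order preserving, so in the
Maxwellian-weighted continuous class `|f| ≤ C M` (`IsMaxwellianBoundedOn`) a weighted
contraction (weight `M(v) exp(Λ (1 + |v|) t)`) gives global existence and uniqueness, and
monotone iteration gives `f ≥ 0`. For a geometry with continuous translation action, a
continuous kernel `B` of linear growth (continuity of `B` is needed for the solution to be
continuous in `v`: a merely measurable `B` gives a discontinuous loss frequency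
`ν(v) = ∫∫ B M`; the hard-sphere kernel `Hilbert6.hardSphereKernel` is continuous) and continuous
data `0 ≤ f₀ ≤ C M` there is `f` with `f 0 = f₀` which, for every `T ≥ 0`, is a mild linear
Boltzmann solution on `[0, T]` in that class; it is unique among such functions on `t ≥ 0`
(values at negative times are unconstrained, whence no `∃!` on the function itself; the outline
name `existsUnique_…` is kept). [cite: BodineauGallagherSaintRaymond2016, §2  (1.7] -/
def existsUnique_mildLinearBoltzmann : Prop :=
  ∀ [TopologicalSpace X] (G : FluidPDE.Geometry d X) (hG : Continuous fun p : X × EuclideanSpace ℝ d => G.translate p.1 p.2) {B : EuclideanSpace ℝ d × EuclideanSpace ℝ d → sphere (0 : EuclideanSpace ℝ d) 1 → ℝ} (hB : FluidPDE.IsGradCutoffKernel B) (hBc : Continuous (Function.uncurry B)) (f₀ : X → EuclideanSpace ℝ d → ℝ) (hf₀ : Continuous (Function.uncurry f₀)) (h0 : ∀ x v, 0 ≤ f₀ x v) (hbdd : ∃ C, ∀ x v, f₀ x v ≤ C * FluidPDE.globalMaxwellian v),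
    ∃ f : ℝ → X → EuclideanSpace ℝ d → ℝ,
      (f 0 = f₀ ∧ ∀ T, 0 ≤ T →
        IsMildLinearBoltzmannSolutionOn T G B FluidPDE.globalMaxwellian f ∧ IsMaxwellianBoundedOn T f) ∧
      ∀ g : ℝ → X → EuclideanSpace ℝ d → ℝ, g 0 = f₀ →
        (∀ T, 0 ≤ T →
          IsMildLinearBoltzmannSolutionOn T G B FluidPDE.globalMaxwellian g ∧ IsMaxwellianBoundedOn T g) →
        ∀ t, 0 ≤ t → g t = f t

end MildLinear

/-! ## 3. A tagged sphere in a hard-sphere gas -/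

section Tagged

variable {d : Type*} [Fintype d] {X : Type*} [MeasureSpace X] [TopologicalSpace X]
  {G : FluidPDE.Geometry d X} {ε : ℝ} {N : ℕ}

/-- The one-time law at time `t` of the *tagged* particle `0` of an `(N+1)`-hard-sphere system
started from the initial law `W₀ dZ` (`dZ` the Liouville measure `liouville G (N+1) ε`):
push the initial law forward by the flow `Φ_t` and project on the coordinate `z ↦ z 0 ∈ X × ℝ^d`
(Bodineau–Gallagher–Saint-Raymond, Invent. Math. 203 (2016) (1.5)–(1.6): the law of
`(x₁(t), v₁(t))`, whose density is the first marginal `f_N^{(1)}(t)`). [folklore] -/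
def taggedLaw (Φ : FluidPDE.HardSphereFlow G ε (N + 1)) (W₀ : FluidPDE.Config (N + 1) d X → ℝ≥0∞) (t : ℝ) :
    Measure (X × EuclideanSpace ℝ d) :=
  (((FluidPDE.liouville G (N + 1) ε).withDensity W₀).map (Φ.flow t)).map fun z => z 0

/-- `taggedLaw` is the tagged-coordinate marginal of G12's `HardSphereFlow.lawAt` of the initial
law `W₀ dZ` (so that `HardSphereFlow.lawAt_withDensity` applies downstream). [folklore] -/
theorem taggedLaw_eq_map_lawAt (Φ : FluidPDE.HardSphereFlow G ε (N + 1)) (W₀ : FluidPDE.Config (N + 1) d X → ℝ≥0∞)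
    (t : ℝ) :
    taggedLaw Φ W₀ t = (Φ.lawAt ((FluidPDE.liouville G (N + 1) ε).withDensity W₀) t).map fun z => z 0 :=
  rfl

/-- The one-time law at time `t` of the *position* of the tagged particle: the first marginal
of `taggedLaw` (BGSR 2016 Thm 1.2: the process `x₁(αt)` whose diffusive limit is a Brownian
motion on the torus). [cite: BGSR2016, Thm 1.2: the process  x₁(αt] -/
def taggedPositionLaw (Φ : FluidPDE.HardSphereFlow G ε (N + 1)) (W₀ : FluidPDE.Config (N + 1) d X → ℝ≥0∞)
    (t : ℝ) : Measure X :=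
  (taggedLaw Φ W₀ t).map Prod.fst

/-- Unfolding lemma for `taggedPositionLaw`. [folklore] -/
theorem taggedPositionLaw_eq (Φ : FluidPDE.HardSphereFlow G ε (N + 1)) (W₀ : FluidPDE.Config (N + 1) d X → ℝ≥0∞)
    (t : ℝ) : taggedPositionLaw Φ W₀ t = (taggedLaw Φ W₀ t).map Prod.fst := rfl

/-- The Maxwellian at inverse temperature `β`,
`M_β(v) = (β / 2π)^{d/2} exp (-β |v|² / 2)` (BGSR 2016 (1.3)), as G12's local Maxwellian with
unit density, zero bulk velocity and temperature `β⁻¹`. Meaningful for `β > 0`.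
[cite: BGSR2016, (1.3] -/
def maxwellianBeta (β : ℝ) (v : EuclideanSpace ℝ d) : ℝ :=
  FluidPDE.localMaxwellian 1 β⁻¹ 0 v

/-- At `β = 1` the inverse-temperature Maxwellian is the global Maxwellian. [folklore] -/
@[simp]
theorem maxwellianBeta_one : maxwellianBeta (d := d) 1 = FluidPDE.globalMaxwellian := by
  funext v
  simp [maxwellianBeta]

/-- The Maxwellian `M_β` is positive for `β > 0`. [folklore] -/
theorem maxwellianBeta_pos {β : ℝ} (hβ : 0 < β) (v : EuclideanSpace ℝ d) :
    0 < maxwellianBeta β v := by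
  unfold maxwellianBeta FluidPDE.localMaxwellian
  refine mul_pos (mul_pos one_pos (rpow_pos_of_pos (by positivity) _)) (exp_pos _)

variable (G ε N) in
/-- The partition function `𝒵_{N+1} = ∫ 𝟙_{D_ε^{N+1}}(Z) ∏ᵢ M_β(vᵢ) dZ` normalising the
hard-sphere Gibbs measure (BGSR 2016 (1.4); `1 ≥ 𝒵_N > 0` on the torus in the dilute regime).
This is G12's `canonicalPartition G ε (N + 1)` (BBGKYMarginals) of the one-particle density
`(x, v) ↦ M_β(v)`: a Bochner integral against Lebesgue measure `volume` on `Config (N+1) d X`,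
junk value `0` if not integrable (e.g. `X = ℝ^d`); positivity on the torus is
`equilibriumTaggedPartition_pos`. [cite: BGSR2016, (1.4] -/
def equilibriumTaggedPartition (β : ℝ) : ℝ :=
  FluidPDE.canonicalPartition G ε (N + 1) fun p => maxwellianBeta β p.2

omit [TopologicalSpace X] in
/-- The partition function is the integral of the Gibbs weight `𝟙_{D_ε^{N+1}} M_β^{⊗(N+1)}`.
[folklore] -/
theorem equilibriumTaggedPartition_eq (β : ℝ) :
    equilibriumTaggedPartition G ε N β = ∫ z, (FluidPDE.hardSphereDomain G (N + 1) ε).indicator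
      (FluidPDE.tensorPow (N + 1) fun p => maxwellianBeta β p.2) z :=
  rfl

variable (G ε N) in
/-- The perturbed-equilibrium initial density of BGSR 2016 (1.4)–(1.5):
`f⁰_{N+1}(Z) = 𝒵⁻¹ 𝟙_{D_ε^{N+1}}(Z) ∏ᵢ M_β(vᵢ) · h₀(z₀)` — the hard-sphere Gibbs density, i.e.
G12's `canonicalDensity G ε (N + 1) ((x, v) ↦ M_β(v))` (BBGKYMarginals, GST 2013 (6.1.2)), with
the law of the tagged particle `0` tilted by `h₀ : X × ℝ^d → ℝ` (in BGSR `h₀ = ρ⁰(x₁)` depends on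
the position only, `∫ ρ⁰ = 1`), as an `ℝ≥0∞`-valued density for `liouville … |>.withDensity`.
Junk: `ENNReal.ofReal` clips negative values, and `𝒵⁻¹ = 0` if `𝒵 = 0` (inherited from
`canonicalDensity`). The accepted statement-local `Hilbert6.taggedDensity` (Statements/Hilbert6/
Sweep1) is the special case `β = 1`, `h₀ = ρ₀ ∘ Prod.fst`, real-valued and normalised jointly.
[cite: BGSR2016, (1.4] -/
def equilibriumTaggedDensity (β : ℝ) (h₀ : X × EuclideanSpace ℝ d → ℝ) :
    FluidPDE.Config (N + 1) d X → ℝ≥0∞ :=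
  fun z =>
    ENNReal.ofReal (FluidPDE.canonicalDensity G ε (N + 1) (fun p => maxwellianBeta β p.2) z * h₀ (z 0))

omit [TopologicalSpace X] in
/-- Unfolding `equilibriumTaggedDensity` to `𝒵⁻¹ 𝟙_{D_ε} M_β^{⊗(N+1)}(Z) h₀(z₀)`. [folklore] -/
theorem equilibriumTaggedDensity_apply (β : ℝ) (h₀ : X × EuclideanSpace ℝ d → ℝ)
    (z : FluidPDE.Config (N + 1) d X) :
    equilibriumTaggedDensity G ε N β h₀ z =
      ENNReal.ofReal ((equilibriumTaggedPartition G ε N β)⁻¹ *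
        (FluidPDE.hardSphereDomain G (N + 1) ε).indicator
          (FluidPDE.tensorPow (N + 1) fun p => maxwellianBeta β p.2) z * h₀ (z 0)) :=
  rfl

omit [TopologicalSpace X] in
/-- The perturbed-equilibrium density vanishes off the hard-sphere domain. [folklore] -/
theorem equilibriumTaggedDensity_of_notMem {β : ℝ} {h₀ : X × EuclideanSpace ℝ d → ℝ}
    {z : FluidPDE.Config (N + 1) d X} (hz : z ∉ FluidPDE.hardSphereDomain G (N + 1) ε) :
    equilibriumTaggedDensity G ε N β h₀ z = 0 := by
  simp [equilibriumTaggedDensity, FluidPDE.canonicalDensity, Set.indicator_of_notMem hz]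

/-- **Positivity of the partition function on the torus** (BGSR 2016 after (1.4)): for
`β > 0` and a hard-sphere domain `D_ε^{N+1} ⊆ (T^d × ℝ^d)^{N+1}` of positive Lebesgue measure
(i.e. `N + 1` spheres of diameter `ε` fit in the unit torus with room to spare — automatic in the
dilute regime `N ε^{d-1} = α`, `ε → 0`), `0 < 𝒵_{N+1}` (and `𝒵_{N+1} ≤ 1`). The weight is a product
of Gaussians times an indicator, hence integrable on `(T^d × ℝ^d)^{N+1}`.
[cite: BGSR2016, after (1.4] -/
def equilibriumTaggedPartition_pos : Prop :=
  ∀ {β : ℝ} (hβ : 0 < β) {ε : ℝ} (N : ℕ) (hD : volume (FluidPDE.hardSphereDomain (FluidPDE.Torus.geometry d) (N + 1) ε) ≠ 0),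
    0 < equilibriumTaggedPartition (FluidPDE.Torus.geometry d) ε N β

/-- On the torus the partition function is at most `1` for `β > 0` (drop the indicator; each
`M_β` has unit mass and `T^d` unit volume; BGSR 2016 after (1.4)). [cite: BGSR2016, after (1.4] -/
def equilibriumTaggedPartition_le_one : Prop :=
  ∀ {β : ℝ} (hβ : 0 < β) (ε : ℝ) (N : ℕ),
    equilibriumTaggedPartition (FluidPDE.Torus.geometry d) ε N β ≤ 1

/-- With `h₀ ≥ 0` of unit mean under the tagged marginal of the Gibbs measure, the
perturbed-equilibrium density is a probability density for the Liouville measure on the torus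
(BGSR 2016 (1.5): `∫ f⁰_{N+1} dZ = 1`). Stated with the normalisation hypothesis explicitly; the
Bochner normalisation `= 1` already forces `𝒵 ≠ 0` and integrability (hence measurability) of
the integrand, and the integrand vanishes off `D_ε`, so no further hypotheses are needed.
[cite: BGSR2016, (1.5] -/
def lintegral_equilibriumTaggedDensity : Prop :=
  ∀ {β : ℝ} (hβ : 0 < β) {ε : ℝ} {N : ℕ} {h₀ : UnitAddTorus d × EuclideanSpace ℝ d → ℝ} (hh₀ : ∀ p, 0 ≤ h₀ p) (hnorm : ∫ z, FluidPDE.canonicalDensity (FluidPDE.Torus.geometry d) ε (N + 1) (fun p => maxwellianBeta β p.2) z * h₀ (z 0) = 1),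
    ∫⁻ z, equilibriumTaggedDensity (FluidPDE.Torus.geometry d) ε N β h₀ z
      ∂FluidPDE.liouville (FluidPDE.Torus.geometry d) (N + 1) ε = 1

end Tagged

end

end Literature.Analysis.FunctionSpaces
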